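import Summits.QuantumFields.YangMills.Theses.LangevinControlUV

/-!
# Continuous rulers — under the repair C′ of `LatticeGapInUVUnits`, admissible unit maps lie below the bare-perturbative thresholds

Negative-side support file for crux `stmt-QuantumFields-9366` =
`Summit.QuantumFields.YangMills.Theses.LangevinControlUV.LatticeGapInUVUnits` (route `LangevinControlUV`, rank 5).
Tree objects only; no definition is introduced.

The crux as typed quantifies over EVERY unit map `a` carrying the femto two-point package, and is false in the
standard scaling picture because slowly decaying STEP rulers are admissible (negative lemma
`Negative/LatticeGapInUVUnitsFalseOfStandardScalingSU.lean`, rulers from `Negative/SlowRulers.lean`: they satisfy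
`a(β) > 1/(L_pert(β) + 2)` with `L_pert(β)` the largest torus side in its `β⁻²` regime at coupling `β`). The
refuter's repair C′ restricts the crux to CONTINUOUS unit maps. This file proves that C′ kills that witness family
for a checkable reason, using only two one-sided pieces of information:

* `ruler_lt_of_continuous`: if a continuous `a → 0` satisfies the package's axis LOWER bound
  `c Γ(n a(β)) ≤ n⁸ Cov_{β,L}(P_0^{01}, P_{ne₂}^{01})` on femto boxes (`L a(β) ≤ ℓ₀`, `β ≥ β₀`, `Γ > 0` on `(0, ℓ₀]`)
  and the tori obey the fixed-torus UPPER bound `β² n⁸ Cov_{β,L} ≤ C₀` beyond thresholds `B(L)`, then for every level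
  `0 < s ≤ ℓ₀/8` there is `βm` with `a(β) < s/n` for all `n ≥ 1` and all `β ≥ max(β₀, B(8n), βm)` — i.e.
  `a(β) ≤ 8 s / L_pert(β)`: honest rulers are pinned from the SLOW side by the bare-perturbative thresholds
  (physically `L_pert(β) ≈ e^{β/(8 N b₀)}`), and their femto-edge boxes are never bare-perturbative — dimensional
  transmutation is forced into any proof of the package under C′;
* `level_attained_of_continuous`: non-vacuity — a continuous positive `a → 0` passes every level `s/n` at some
  coupling `≥ β₀` for all large `n` (intermediate values).
-/

namespace Summit.QuantumFields.YangMills.Theorems.LatticeGapInUVUnits.Negative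

open Filter Topology MeasureTheory
open Literature.MathematicalPhysics.QuantumFieldTheory Literature.MathematicalPhysics.QuantumLattice

noncomputable section

variable {G : Type} [Group G] [TopologicalSpace G] [IsTopologicalGroup G] [CompactSpace G]
  [MeasurableSpace G] [BorelSpace G]

/-- **Continuous admissible rulers are pinned from the slow side by fixed-torus UPPER bounds.** Hypotheses: the
axis LOWER bound of the femto two-point package for a continuous unit map `a → 0` (shape `Γ > 0` on `(0, ℓ₀]`,
constant `c > 0`), and the UPPER half of the fixed-torus `β⁻²` asymptotics beyond arbitrary thresholds `B(L)`.
Conclusion: for every level `0 < s ≤ ℓ₀ / 8` there is `βm` such that `a(β) < s / n` whenever `n ≥ 1` and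
`β ≥ max(β₀, B(8n), βm)`. Proof: otherwise continuity and `a → 0` give `β' ≥ β` with `a(β') = s/n` (intermediate
values); the box `L = 8n` is femto at `β'` (`8n · s/n = 8s ≤ ℓ₀`), so `c Γ(s) ≤ n⁸ Cov ≤ C₀ / β'²`, i.e.
`β' ≤ √(max(C₀,0)/(c Γ(s)))`, absurd for `β > √(max(C₀,0)/(c Γ(s)))`. [folklore] -/
theorem ruler_lt_of_continuous (r : LatticeRep G) {a Γ : ℝ → ℝ} {β₀ ℓ₀ c : ℝ} (hc : 0 < c)
    (hlim : Tendsto a atTop (𝓝 0)) (ha : Continuous a)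
    (hΓ : ∀ s : ℝ, 0 < s → s ≤ ℓ₀ → 0 < Γ s)
    (hlow : ∀ (L : ℕ) [NeZero L] (β : ℝ), β₀ ≤ β → (L : ℝ) * a β ≤ ℓ₀ → ∀ n : ℕ, 1 ≤ n → 8 * n ≤ L →
      c * Γ ((n : ℝ) * a β) ≤ (n : ℝ) ^ 8 *
        (wilsonExpectation (d := 4) (L := L) r.ρ β
            (fun U => ((r.N : ℝ) - (r.ρ (plaquetteHolonomy U 0 0 1)).trace.re) *
              ((r.N : ℝ) - (r.ρ (plaquetteHolonomy U (Pi.single (2 : Fin 4) ((n : ℕ) : ZMod L)) 0 1)).trace.re)) -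
          wilsonExpectation (d := 4) (L := L) r.ρ β
              (fun U => (r.N : ℝ) - (r.ρ (plaquetteHolonomy U 0 0 1)).trace.re) *
            wilsonExpectation (d := 4) (L := L) r.ρ β
              (fun U => (r.N : ℝ) - (r.ρ (plaquetteHolonomy U (Pi.single (2 : Fin 4) ((n : ℕ) : ZMod L)) 0 1)).trace.re)))
    {C₀ : ℝ} {B : ℕ → ℝ}
    (hB : ∀ (L : ℕ) [NeZero L] (β : ℝ), B L ≤ β → ∀ n : ℕ, 1 ≤ n → 8 * n ≤ L →
      β ^ 2 * ((n : ℝ) ^ 8 *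
        (wilsonExpectation (d := 4) (L := L) r.ρ β
            (fun U => ((r.N : ℝ) - (r.ρ (plaquetteHolonomy U 0 0 1)).trace.re) *
              ((r.N : ℝ) - (r.ρ (plaquetteHolonomy U (Pi.single (2 : Fin 4) ((n : ℕ) : ZMod L)) 0 1)).trace.re)) -
          wilsonExpectation (d := 4) (L := L) r.ρ β
              (fun U => (r.N : ℝ) - (r.ρ (plaquetteHolonomy U 0 0 1)).trace.re) *
            wilsonExpectation (d := 4) (L := L) r.ρ β
              (fun U => (r.N : ℝ) - (r.ρ (plaquetteHolonomy U (Pi.single (2 : Fin 4) ((n : ℕ) : ZMod L)) 0 1)).trace.re)))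
        ≤ C₀)
    {s : ℝ} (hs : 0 < s) (hsℓ : s ≤ ℓ₀ / 8) :
    ∃ βm : ℝ, ∀ n : ℕ, 1 ≤ n → ∀ β : ℝ, β₀ ≤ β → B (8 * n) ≤ β → βm ≤ β → a β < s / n := by
  have hsℓ' : s ≤ ℓ₀ := by linarith
  have hΓs : 0 < Γ s := hΓ s hs hsℓ'
  -- beyond `βm`, `C₀ / β² < c Γ(s)`
  set βm : ℝ := Real.sqrt (max C₀ 0 / (c * Γ s)) + 1 with hβm
  refine ⟨βm, fun n hn β hβ₀ hBβ hβmβ => ?_⟩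
  have hn0 : (0 : ℝ) < n := by exact_mod_cast hn
  by_contra hge
  push Not at hge
  -- a coupling `β' ≥ β` at which the ruler passes the level `s / n`
  obtain ⟨β', hββ', hlevel⟩ : ∃ β', β ≤ β' ∧ a β' = s / n := by
    have hev : ∀ᶠ x in atTop, a x < s / n := hlim (Iio_mem_nhds (div_pos hs hn0))
    obtain ⟨β₂, hβ₂ge, hβ₂lt⟩ := ((eventually_ge_atTop β).and hev).exists
    obtain ⟨β', hβ'mem, hβ'eq⟩ := intermediate_value_Icc' hβ₂ge ha.continuousOn ⟨hβ₂lt.le, hge⟩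
    exact ⟨β', hβ'mem.1, hβ'eq⟩
  have hβ'₀ : β₀ ≤ β' := hβ₀.trans hββ'
  have hβ'B : B (8 * n) ≤ β' := hBβ.trans hββ'
  have hβ'pos : 0 < β' := by
    have : (0 : ℝ) < βm := by rw [hβm]; positivity
    linarith [hβmβ.trans hββ']
  -- the box `L = 8 n` is femto at `β'`
  haveI : NeZero (8 * n) := ⟨by omega⟩
  have hfemto : ((8 * n : ℕ) : ℝ) * a β' ≤ ℓ₀ := by
    rw [hlevel]; push_cast
    field_simp
    linarith
  have h1 := hlow (8 * n) β' hβ'₀ hfemto n hn le_rfl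
  have h2 := hB (8 * n) β' hβ'B n hn le_rfl
  rw [hlevel, show (n : ℝ) * (s / n) = s by field_simp] at h1
  -- `c Γ(s) ≤ n⁸ Cov ≤ C₀ / β'²`
  set X := (n : ℝ) ^ 8 *
    (wilsonExpectation (d := 4) (L := 8 * n) r.ρ β'
        (fun U => ((r.N : ℝ) - (r.ρ (plaquetteHolonomy U 0 0 1)).trace.re) *
          ((r.N : ℝ) - (r.ρ (plaquetteHolonomy U (Pi.single (2 : Fin 4) ((n : ℕ) : ZMod (8 * n))) 0 1)).trace.re)) -
      wilsonExpectation (d := 4) (L := 8 * n) r.ρ β'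
          (fun U => (r.N : ℝ) - (r.ρ (plaquetteHolonomy U 0 0 1)).trace.re) *
        wilsonExpectation (d := 4) (L := 8 * n) r.ρ β'
          (fun U => (r.N : ℝ) - (r.ρ (plaquetteHolonomy U (Pi.single (2 : Fin 4) ((n : ℕ) : ZMod (8 * n))) 0 1)).trace.re))
    with hX
  have hcΓ : 0 < c * Γ s := mul_pos hc hΓs
  have hβ'2 : 0 < β' ^ 2 := by positivity
  have h3 : β' ^ 2 * (c * Γ s) ≤ max C₀ 0 :=
    (mul_le_mul_of_nonneg_left h1 hβ'2.le).trans (h2.trans (le_max_left _ _))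
  have h4 : β' ^ 2 ≤ max C₀ 0 / (c * Γ s) := by rw [le_div_iff₀ hcΓ]; exact h3
  have h5 : β' ≤ Real.sqrt (max C₀ 0 / (c * Γ s)) := by
    rw [← Real.sqrt_sq hβ'pos.le]
    exact Real.sqrt_le_sqrt h4
  have h6 : βm ≤ β' := hβmβ.trans hββ'
  rw [hβm] at h6
  linarith

omit [TopologicalSpace G] [IsTopologicalGroup G] [CompactSpace G] [MeasurableSpace G] [BorelSpace G] [Group G] in
/-- **Non-vacuity: continuous rulers DO pass every level at arbitrarily large couplings.** For a continuous unit map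
`a > 0`, `a → 0`, a threshold `β₀` and a level `s > 0`: for all large `n` there is a coupling `β ≥ β₀` with
`a(β) = s/n` (intermediate values between `β₀`, where `a(β₀) > s/n` once `n > s / a(β₀)`, and a coupling where
`a < s/n`). Combined with `ruler_lt_of_continuous`, these couplings all lie below `max(B(8n), βm)`. [folklore] -/
theorem level_attained_of_continuous {a : ℝ → ℝ} (ha : Continuous a) (hpos : ∀ β, 0 < a β)
    (hlim : Tendsto a atTop (𝓝 0)) (β₀ : ℝ) {s : ℝ} (hs : 0 < s) :
    ∀ᶠ n : ℕ in atTop, ∃ β : ℝ, β₀ ≤ β ∧ a β = s / n := by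
  have hev : ∀ᶠ n : ℕ in atTop, s / a β₀ < n := tendsto_natCast_atTop_atTop.eventually_gt_atTop _
  filter_upwards [hev, eventually_ge_atTop 1] with n hn hn1
  have hn0 : (0 : ℝ) < n := by exact_mod_cast hn1
  have hlev : s / n < a β₀ := by
    rw [div_lt_iff₀ hn0]
    rw [div_lt_iff₀ (hpos β₀)] at hn
    linarith [mul_comm (a β₀) (n : ℝ)]
  have hev' : ∀ᶠ x in atTop, a x < s / n := hlim (Iio_mem_nhds (div_pos hs hn0))
  obtain ⟨β₂, hβ₂ge, hβ₂lt⟩ := ((eventually_ge_atTop β₀).and hev').exists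
  obtain ⟨β, hβmem, hβeq⟩ := intermediate_value_Icc' hβ₂ge ha.continuousOn ⟨hβ₂lt.le, hlev.le⟩
  exact ⟨β, hβmem.1, hβeq⟩

end

end Summit.QuantumFields.YangMills.Theorems.LatticeGapInUVUnits.Negative
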